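import Summits.FinalStateConjecture.FinalStateConjecture.Theses.CurvatureOrSymmetry
import Literature.Geometry.Lorentzian.VisibleIncompleteNullRay
import Literature.Geometry.Lorentzian.PPCurvatureSingularity
import HarnessLib.Audit

/-!
# Birth skeleton (BC3) — crux `CurvatureOrSymmetry.TameCurvatureModeExit` (stmt-FinalStateConjecture-17347)

Registrar: planner-skel-stmt-FinalStateConjecture-17347-0, 2026-08-17 (route re-audit bin REPAIRABLE;
published as `Cruxes/TameCurvatureModeExit/Lines/birth.lean`).  The crux is FIXED and concluded BY NAME:

  `Summit.FinalStateConjecture.FinalStateConjecture.Theses.CurvatureOrSymmetry.TameCurvatureModeExit`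

(rank 4 of route CurvatureOrSymmetry; "the tame `NakedDataExit` of TangentProfileCensorship with the
Step-1 object supplied as hypothesis"): for every admissible datum `D` owning an MGHD with INCOMPLETE
`𝓘⁺` and a VISIBLE future-incomplete null geodesic ending BY CURVATURE (p.p. blow-up, alternative (a)
of `NoFourthExit`), there pass, on one asymptotically flat end `e` of `X`, a TAME (`IsTameDataFamily`),
IMMERSED-at-`0` (`IsImmersedAtZero`), injective curve `F` of admissible data with `F 0 = D` and an
`ε > 0` such that the members with `0 < ‖c‖ < ε` are GOOD (an MGHD exists; every MGHD has complete `𝓘⁺`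
and a sub-extremal Kerr final-state decomposition of its self-determined exterior with
`RaysStayInClosure`, honest `HasExhaustiveCharts`, `IsFutureOriented`).

## The cut (two named stubs, composition kernel-checked)

GOOD is a conjunction — CENSORED (every MGHD has complete `𝓘⁺`) and SETTLES — and Christodoulou
genericity is NOT closed under conjunction (route `RobustClausewiseGenericity`, item `PlanarNonClosure`;
card `genericity-is-not-closed-under-and`).  The tree's sanctioned door through which a generic
HYPOTHESIS enters the proof of a generic CONCLUSION is the RELATIVE form
(`Literature/Geometry/Lorentzian/TameGenericityDiagonal.lean`,
`InitialDataSet.isTameChristodoulouGeneric_of_relative'`: "genericity is produced along `Q`-curves,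
never by conjunction").  This file cuts the crux along exactly that door, at the p.p.-naked datum:

* `stub_censoringExit` (open-problem, the blow-up half — THE LOAD-BEARING STUB): through every
  admissible p.p.-naked datum `D` passes a tame, immersed, injective admissible curve on one end whose
  members with `0 < ‖c‖ < ε` are CENSORED.  This is the instability of naked singularities in
  Christodoulou's positive-codimension form (CQG 16 (1999) A23 p. A24; Ann. Math. 149 (1999) 183,
  Thm. 4.1 — spherically symmetric scalar field), asked in vacuum, without symmetry, in the TAME class
  (fixed end, Dafermos–Rodnianski weights), with the blow-up object of `NoFourthExit` (a visible
  p.p.-singular ray, Hawking–Ellis §8.1 p. 260) supplied.  Everything the route header foresees under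
  this crux — `ScaleCriticalUpgrade` (KRS continuation on collapsing-lapse foliations), `MinimalSingularTip`,
  TangentProfileCensorship's profile extraction / smooth-class instability / two-sided exit — lives INSIDE
  this stub (lemmas `--supports`, never items, D-0019); the data-side realisation of the exit direction
  as a TAME admissible curve (weighted constraint gluing, CorvinoSchoen2006 / ChruscielDelay2003) too.
  Why it might fail: p.p. blow-up on ONE visible ray is weaker than the scale-critical concentration the
  blow-up analysis consumes; threshold-regular naked singularities are STABLE (arXiv:2605.16235), so the
  instability must come from smoothness + tameness of the admissible class.
* `stub_settlingAlongCensoredCurves` (open-problem, the final-state half in RELATIVE form): given an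
  admissible `D` which is NOT censored (the only trace of nakedness this half uses) AND a tame immersed
  injective admissible curve `F` through `D` on an end `e` whose small members are censored, there is (on
  a possibly re-chosen end `e'`) a tame immersed injective admissible curve `F'` through `D` whose small
  members are GOOD.  Intended proof: enrich `F` to a tame
  two-parameter family `G (c, s)` with `G (c, 0) = F c` (Christodoulou's planes `α₀ + λ₁ f₁ + λ₂ f₂`,
  Ann. Math. 149 p. 187; gauge/conformal enrichment as in `RobustClausewiseGenericity.GaugeEnrichment`,
  PROVED) and select a curve `c ↦ G (c, σ(c))`, `σ(0) = 0`, through the censored sheet avoiding the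
  non-settling and asymptotically-extremal strata (large-data Kerr asymptotic stability of the censored
  members: DafermosHolzegelRodnianskiTaylor2021, KlainermanSzeftel2023, GiorgiKlainermanSzeftel2022;
  third law / extremal threshold: KehleUnger2025; dispersal side: Christodoulou–Klainerman); the local-to-
  global and re-parametrisation bookkeeping is `TameGenericityLocal.lean` (PROVED).  The conclusion does
  not mention `F` BY DESIGN — it is verbatim the `hrel` shape of `isTameChristodoulouGeneric_of_relative'`
  (the curve may be re-chosen, the base datum may not).  Why it might fail: contains Kerr stability for
  LARGE censored data (known only for `|a| ≪ M`) and non-genericity of extremal / infinitely-many-hole end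
  states ALONG the censoring sheet; a Cantor-like lamination of non-settling censored data crossing every
  tame curve through `D`, or `RaysStayInClosure` failing for honest black-hole members (a future-complete
  null ray from `Σ` inside the hole), refutes it as typed.

The two stubs are individually refutable by DIFFERENT witnesses (a tamely STABLE p.p.-naked vacuum
singularity kills stub 1 only; generic non-settling of censored data near a naked datum kills stub 2 only),
and neither is cheaply the crux or the summit (BC3 probes, registrar NOTES.md / `Lines/birth.md`).

`TameCurvatureModeExit_of (h₁ : Registered.stub_censoringExit) (h₂ : Registered.stub_settlingAlongCensoredCurves) :
TameCurvatureModeExit` is PROVED below (the `Registered.stub_*` abbrevs are the two statements `CensoringExit`,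
`SettlingAlongCensoredCurves` under the stubs' names, as the skeleton audit wants them; pure logic:
the bundles `IsPPNaked` / `IsGood` are token-identical copies of the crux's antecedent / the summit's good
property, so every hand-over is definitional).  `lean check`: sorries ONLY in the two `stub_*`.

Disproof used: none exists for this crux (no `Cruxes/TameCurvatureModeExit/Disproof.lean`; `ledger crux ls`
shows no workfiles; payload carries no `disproof_path`, 2026-08-17).  Negatives index of the summit: one
unrelated entry (`UniformPhotonSphereChannels`); no stub instantiates it.
-/

noncomputable section

open scoped Manifold ContDiff Topology
open Filter Set Function Literature.Geometry.Lorentzian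

namespace Summit.FinalStateConjecture.FinalStateConjecture.Cruxes.TameCurvatureModeExit.Birth

set_option linter.dupNamespace false
set_option linter.unusedVariables false

variable {X : Type} [TopologicalSpace X] [ChartedSpace E3 X] [IsManifold (𝓡 3) ∞ X] [ConnectedSpace X]

/-! ## The crux's bundles, named (token-identical copies of the route decl / the summit statement) -/

/-- **`D` is p.p.-naked** — verbatim the ANTECEDENT of the crux `TameCurvatureModeExit`: some maximal
vacuum Cauchy development `𝒟` of `D` has incomplete future null infinity (sojourn form) and, for the
Levi-Civita connection of its metric granted its existence, carries a maximal null geodesic `γ` with open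
affine domain `dom ∋ 0` bounded above (future-incomplete), future-directed null velocity, VISIBLE (every
`γ t`, `t ≥ 0`, in the chronological past of the nonnegative half of a future-complete normalised null ray
from the data hypersurface), along which some parallelly propagated frame, linearly independent at `0`, has
unbounded curvature components (Hawking–Ellis 1973 §8.1 p. 260: a p.p. curvature singularity).  Packaged
form: `isPPNaked_iff` below. -/
def IsPPNaked (D : InitialDataSet (𝓡 3) X) : Prop :=
  ∃ 𝒟 : VacuumCauchyDevelopment D, 𝒟.IsMaximal ∧
    ¬ Summit.FinalStateConjecture.HasCompleteNullInfinity 𝒟.toCauchyDevelopment ∧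
    ∀ [𝒟.metric.HasLeviCivita], ∃ (γ : ℝ → 𝒟.carrier) (dom : Set ℝ),
      (IsMaximalGeodesicOn 𝒟.metric.leviCivita γ dom ∧ (0 : ℝ) ∈ dom ∧ BddAbove dom ∧
        (∀ t ∈ dom, 𝒟.metric.IsNull (velocity (𝓡 4) γ t) ∧
          𝒟.timeOrientation.IsFutureDirected (velocity (𝓡 4) γ t)) ∧
        (∀ t ∈ dom, 0 ≤ t → (∃ (p : X) (δ : ℝ → 𝒟.carrier) (s : Set ℝ),
          𝒟.metric.IsNormalisedNullRayFrom 𝒟.timeOrientation 𝒟.embed 𝒟.normal p δ s ∧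
            ¬ BddAbove s ∧
            γ t ∈ 𝒟.metric.chronologicalPast 𝒟.timeOrientation (δ '' (s ∩ Set.Ici 0))))) ∧
      (∃ e : Fin 4 → (Π t : ℝ, TangentSpace (𝓡 4) (γ t)),
        (∀ a, ∀ t ∈ dom, MDifferentiableAt 𝓘(ℝ, ℝ) (𝓡 4).tangent
            (fun s : ℝ ↦ (Bundle.TotalSpace.mk' E4 (γ s) (e a s) : TangentBundle (𝓡 4) 𝒟.carrier)) t ∧
          covariantDerivAlong 𝒟.metric.leviCivita γ (e a) t = 0) ∧
        LinearIndependent ℝ (fun a ↦ e a 0) ∧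
        ∀ C : ℝ, ∃ t ∈ dom, 0 ≤ t ∧ ∃ a b c d : Fin 4,
          C < |𝒟.metric.val (γ t)
            (CovariantDerivative.curvature 𝒟.metric.leviCivita (γ t) (e a t) (e b t) (e c t)) (e d t)|)

/-- **`D` is censored**: every maximal vacuum Cauchy development of `D` has complete future null infinity
(Christodoulou's intrinsic sojourn form, `Summit.FinalStateConjecture.HasCompleteNullInfinity`) — verbatim
the censorship conjunct of the summit's good property (and the case split `hC` of the route's `closes`). -/
def IsCensored (D : InitialDataSet (𝓡 3) X) : Prop :=
  ∀ 𝒟 : VacuumCauchyDevelopment D, 𝒟.IsMaximal →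
    Summit.FinalStateConjecture.HasCompleteNullInfinity 𝒟.toCauchyDevelopment

/-- **`D` is good** — verbatim the summit's property `P` (the CONSEQUENT members of the crux must satisfy):
an MGHD exists, and every MGHD has complete `𝓘⁺` and a sub-extremal `N`-Kerr final-state decomposition `d`
of `O = exteriorOf 𝒟 d.charted` with `RaysStayInClosure`, `HasExhaustiveCharts`, `IsFutureOriented`. -/
def IsGood (D : InitialDataSet (𝓡 3) X) : Prop :=
  (∃ 𝒟 : VacuumCauchyDevelopment D, 𝒟.IsMaximal) ∧
    ∀ 𝒟 : VacuumCauchyDevelopment D, 𝒟.IsMaximal →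
      Summit.FinalStateConjecture.HasCompleteNullInfinity 𝒟.toCauchyDevelopment ∧
        ∃ (O : Set 𝒟.carrier) (d : FinalStateDecomposition 𝒟.toSpacetime O 2),
          (∀ i, Kerr.IsSubextremal (d.mass i) (d.spin i)) ∧
            O = Summit.FinalStateConjecture.exteriorOf 𝒟.toCauchyDevelopment d.charted ∧
              Summit.FinalStateConjecture.RaysStayInClosure 𝒟.toCauchyDevelopment O ∧
                Summit.FinalStateConjecture.HasExhaustiveCharts d ∧
                  Summit.FinalStateConjecture.IsFutureOriented d

/-- **`F` is a tame admissible curve through `D` on the end `e`**: tame on `e` (`IsTameDataFamily e 1 F`),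
immersed at `0` (`IsImmersedAtZero 1 F`), `F 0 = D`, injective, all members admissible — verbatim the first
five conjuncts of the crux's consequent (and of `IsTameChristodoulouGeneric`'s witness). -/
def IsTameCurveThrough (e : AFEnd X) (F : EuclideanSpace ℝ (Fin 1) → InitialDataSet (𝓡 3) X)
    (D : InitialDataSet (𝓡 3) X) : Prop :=
  InitialDataSet.IsTameDataFamily e 1 F ∧ InitialDataSet.IsImmersedAtZero 1 F ∧ F 0 = D ∧
    Injective F ∧ ∀ c, F c ∈ admissibleVacuumData X

/-- **The members of `F` with `0 < ‖c‖ < ε` (some `ε > 0`) satisfy `P`** — the LOCAL exit shape of the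
crux's consequent (local suffices: `InitialDataSet.isTameChristodoulouGeneric_of_local`, PROVED). -/
def EventuallyOffZero (F : EuclideanSpace ℝ (Fin 1) → InitialDataSet (𝓡 3) X)
    (P : InitialDataSet (𝓡 3) X → Prop) : Prop :=
  ∃ ε : ℝ, 0 < ε ∧ ∀ c, c ≠ 0 → ‖c‖ < ε → P (F c)

/-! ## The two stub STATEMENTS (named, so that the skeleton theorem takes them BY NAME) -/

/-- **Stub statement 1 — `CensoringExit`: the censoring exit at a p.p.-naked datum** (open-problem; THE
LOAD-BEARING STATEMENT: instability of naked singularities in positive-codimension, TAME form).  For every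
connected Hausdorff second-countable smooth `3`-manifold `X` and every admissible datum `D` which is
p.p.-naked (`IsPPNaked`: an MGHD with incomplete `𝓘⁺` and a visible p.p.-singular future-incomplete null
geodesic), there are ONE asymptotically flat end `e` of `X` and a tame, immersed-at-`0`, injective curve `F`
of admissible data with `F 0 = D` whose members with `0 < ‖c‖ < ε` are CENSORED (every MGHD has complete
`𝓘⁺`).  Intended proof (card K4 + TangentProfileCensorship Steps 1–5): upgrade the p.p. blow-up along the
visible ray to scale-critical curvature concentration at a ⊂-minimal visible singular TIP with regular past
cone (KRS continuation criterion run on lapse-collapsing foliations), extract the tangent (CSS/DSS) profile,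
use its smooth-class linear instability to find a compactly supported first-order data perturbation
`(ḣ, k̇)` TRANSVERSAL to the naked stratum, realise it as a tame admissible curve by weighted constraint
gluing on `D`'s own end (Corvino–Schoen / Chruściel–Delay: DR-flatness and continuous mass preserved,
immersion = `(ḣ, k̇) ≠ 0`), and show by Cauchy stability up to the concentration scale plus trapped-surface
formation (Christodoulou 2009 / An–Luk) or dispersal on the two sides that no member with small `c ≠ 0` has
an MGHD with incomplete `𝓘⁺`.  Why it might fail: p.p. blow-up on ONE visible ray is weaker than the
scale-critical concentration the analysis consumes (KRS on collapsing-lapse foliations is open);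
threshold-regular naked singularities are STABLE (arXiv:2605.16235), so instability must use smoothness +
tameness; two-sided or Cantor accumulation of naked data at `D` along every tame curve would refute it — and
with it the censorship conjunct of the typed summit (shared fate with
`TangentProfileCensorship.NakedDataTameExit`, which implies this statement by discarding the ray).  Sources:
Christodoulou1999instability (Ann. Math. 149, Thm. 4.1), Christodoulou1999 (CQG 16, p. A24),
RodnianskiShlapentokhRothman2023, arXiv:2204.09891, arXiv:1912.08478, KlainermanRodnianskiSzeftel2015,
arXiv:2605.16235, An2025, CorvinoSchoen2006, ChruscielDelay2003, HawkingEllis1973 §8.1. -/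
def CensoringExit : Prop :=
  ∀ (X : Type) [TopologicalSpace X] [ChartedSpace E3 X] [IsManifold (𝓡 3) ∞ X] [T2Space X]
    [SecondCountableTopology X] [ConnectedSpace X],
    ∀ D ∈ admissibleVacuumData X, IsPPNaked D →
      ∃ (e : AFEnd X) (F : EuclideanSpace ℝ (Fin 1) → InitialDataSet (𝓡 3) X),
        IsTameCurveThrough e F D ∧ EventuallyOffZero F IsCensored

/-- **Stub statement 2 — `SettlingAlongCensoredCurves`: settling along censoring curves at naked data**
(open-problem; the final-state half of the crux in the RELATIVE form of
`InitialDataSet.isTameChristodoulouGeneric_of_relative'`, i.e. its `hrel` hypothesis in the case of a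
`Q`-exceptional base datum, `Q` = censored, `P` = good, restricted to immersed injective curves censored
LOCALLY).  For every admissible datum `D` which is NOT censored (some MGHD has incomplete `𝓘⁺` — the only
trace of nakedness the final-state half uses), every end `e` and every tame, immersed-at-`0`, injective curve
`F` of admissible data with `F 0 = D` whose members with `0 < ‖c‖ < ε` are censored, there are an end `e'`
(re-chosen at will: another collar/chart of the sole end) and a tame, immersed-at-`0`, injective curve `F'`
of admissible data with `F' 0 = D` whose members with `0 < ‖c‖ < ε'` are GOOD (`IsGood`: MGHD exists, every
MGHD has complete `𝓘⁺` and a sub-extremal Kerr final-state decomposition of its self-determined exterior with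
`RaysStayInClosure`, `HasExhaustiveCharts`, `IsFutureOriented`).  The conclusion does not mention `F` by
design (relative genericity: the curve may be re-chosen, the base datum may not); the base is required
exceptional so that nothing is claimed through GOOD data (no tame-openness of the good set is smuggled in).
Intended proof: enrich `F` to a tame two-parameter admissible family `G (c, s)`, `G (c, 0) = F c`
(Christodoulou's planes `α₀ + λ₁ f₁ + λ₂ f₂`; gauge / conformal enrichment keeping the end and the DR
weights, cf. the PROVED `RobustClausewiseGenericity.GaugeEnrichment`); on the censored sheet `{c ≠ 0}` the
members develop complete `𝓘⁺`, and the claim is that the NON-SETTLING censored data (no sub-extremal Kerr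
decomposition of the d.o.c. with rays in closure, exhaustive honest charts, future orientation) form strata
met by the sheet in a set avoidable by a `C^∞` curve `c ↦ (c, σ c)`, `σ 0 = 0`, immersed at `0` — large-data
asymptotic stability of the Kerr family for the black-hole members, Christodoulou–Klainerman dispersal for
the small ones, and the third-law threshold (asymptotically extremal members are a wall, KehleUnger2025 /
AKU) crossed transversally; MGHD existence for the members is Choquet-Bruhat–Geroch (the shared item
`MGHDExistence`); the `ε`-local form suffices by `TameGenericityLocal.lean` (PROVED).  Why it might fail:
contains Kerr stability for LARGE censored data (known only for `|a| ≪ M`, KlainermanSzeftel2023) and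
non-genericity of extremal / infinitely-many-hole end states along the sheet; a Cantor-like lamination of
non-settling censored data crossing every tame curve through `D` refutes it; so does an honest black-hole
member with a future-complete null ray from `Σ` strictly inside the hole (`RaysStayInClosure` is
interior-flavoured) — the latter being a finding against the re-typed Statement (route KILL CRITERIA), not
against the line.  Sources: Christodoulou1999 (CQG 16 p. A24; Ann. Math. 149 p. 187), DafermosLuk2017
(Conj. 1), DafermosHolzegelRodnianskiTaylor2021, KlainermanSzeftel2023, GiorgiKlainermanSzeftel2022,
KehleUnger2025, ChristodoulouKlainerman1993, Bartnik2005, ChruscielDelay2003. -/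
def SettlingAlongCensoredCurves : Prop :=
  ∀ (X : Type) [TopologicalSpace X] [ChartedSpace E3 X] [IsManifold (𝓡 3) ∞ X] [T2Space X]
    [SecondCountableTopology X] [ConnectedSpace X],
    ∀ D ∈ admissibleVacuumData X, ¬ IsCensored D →
      ∀ (e : AFEnd X) (F : EuclideanSpace ℝ (Fin 1) → InitialDataSet (𝓡 3) X),
        IsTameCurveThrough e F D → EventuallyOffZero F IsCensored →
          ∃ (e' : AFEnd X) (F' : EuclideanSpace ℝ (Fin 1) → InitialDataSet (𝓡 3) X),
            IsTameCurveThrough e' F' D ∧ EventuallyOffZero F' IsGood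

/-! ## The two registered stubs (the ONLY sorries of this file) -/

/-- **Registered stub 1 (open-problem, XL, hardest, load-bearing): the censoring exit.**  See
`CensoringExit`. -/
theorem stub_censoringExit : CensoringExit := by
  sorry

/-- **Registered stub 2 (open-problem, XL): settling along censoring curves at naked data.**  See
`SettlingAlongCensoredCurves`. -/
theorem stub_settlingAlongCensoredCurves : SettlingAlongCensoredCurves := by
  sorry

/-! ## Registered texts of the stubs (the skeleton audit admits exactly these names as hypotheses) -/

namespace Registered

/-- Registered text of `stub_censoringExit`. -/
abbrev stub_censoringExit : Prop := CensoringExit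

/-- Registered text of `stub_settlingAlongCensoredCurves`. -/
abbrev stub_settlingAlongCensoredCurves : Prop := SettlingAlongCensoredCurves

end Registered

/-! ## The composition: the crux BY NAME from the two stub statements (no `sorry`) -/

/-- A p.p.-naked datum is not censored: its witnessing MGHD has incomplete `𝓘⁺` (the one trace of the
crux's antecedent the final-state half consumes). -/
theorem IsPPNaked.not_isCensored {D : InitialDataSet (𝓡 3) X} (h : IsPPNaked D) : ¬ IsCensored D := by
  obtain ⟨𝒟, hmax, hinc, -⟩ := h
  exact fun hcens ↦ hinc (hcens 𝒟 hmax)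

/-- **Skeleton theorem — `TameCurvatureModeExit` from the two stubs** (pure logic; the relative door of
`isTameChristodoulouGeneric_of_relative'` specialised to one exceptional base datum): the crux's antecedent
IS `IsPPNaked D` (token-identical); stub 1 hands a censored tame curve through `D`; `D` itself is not
censored (`IsPPNaked.not_isCensored`), so stub 2 turns the curve into a good tame curve through `D`, whose
unbundling IS the crux's consequent (`IsGood` token-identical to the summit's good property). -/
theorem TameCurvatureModeExit_of (h₁ : Registered.stub_censoringExit)
    (h₂ : Registered.stub_settlingAlongCensoredCurves) :
    Summit.FinalStateConjecture.FinalStateConjecture.Theses.CurvatureOrSymmetry.TameCurvatureModeExit := by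
  intro X _ _ _ _ _ _ D hD hnaked
  -- the crux's antecedent is `IsPPNaked D`, definitionally
  have hpp : IsPPNaked D := hnaked
  -- stub 1: a censored tame curve through `D`
  obtain ⟨e, F, hF, hcens⟩ := h₁ X D hD hpp
  -- `D` is censorship-exceptional; stub 2: a good tame curve through `D`
  obtain ⟨e', F', ⟨htame, himm, h0, hinj, hadm⟩, ε, hε, hgood⟩ :=
    h₂ X D hD hpp.not_isCensored e F hF hcens
  -- unbundle `IsGood` into the crux's consequent (definitional)
  exact ⟨e', F', htame, himm, h0, hinj, hadm, ε, hε, fun c hc hcε ↦ hgood c hc hcε⟩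

/-! ## Hand-over sanity (definitional unfoldings; nothing analytic) -/

/-- The crux's antecedent, PACKAGED: `D` is p.p.-naked iff some MGHD with incomplete `𝓘⁺` carries a visible
future-incomplete null ray (`DataEmbedding.IsVisibleIncompleteNullRay`, VisibleIncompleteNullRay.lean) with a
p.p. curvature blow-up towards the future of `0` in a `Fin 4`-frame (`PPCurvatureBlowupAlong`,
PPCurvatureSingularity.lean) — by `Iff.rfl` (both Literature predicates are verbatim the inlined route text).
Recorded so that stub 1's prover may use the packaged API (`isOpen`, `bddAbove`, `not_ppCurvatureBlowupAlong_iff`,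
affine reparametrisation invariance) at no cost. -/
theorem isPPNaked_iff (D : InitialDataSet (𝓡 3) X) :
    IsPPNaked D ↔
      ∃ 𝒟 : VacuumCauchyDevelopment D, 𝒟.IsMaximal ∧
        ¬ Summit.FinalStateConjecture.HasCompleteNullInfinity 𝒟.toCauchyDevelopment ∧
        ∀ [𝒟.metric.HasLeviCivita], ∃ (γ : ℝ → 𝒟.carrier) (dom : Set ℝ),
          𝒟.IsVisibleIncompleteNullRay γ dom ∧ 𝒟.metric.PPCurvatureBlowupAlong (Fin 4) γ dom 0 :=
  Iff.rfl

/-- A good datum is censored (the first conjunct of the good property, MGHD by MGHD). -/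
theorem IsGood.isCensored {D : InitialDataSet (𝓡 3) X} (h : IsGood D) : IsCensored D :=
  fun 𝒟 h𝒟 ↦ (h.2 𝒟 h𝒟).1

/-- The crux's consequent, BUNDLED: it is `∃ e F, IsTameCurveThrough e F D ∧ EventuallyOffZero F IsGood`
(definitional) — so the crux reads `∀ X, ∀ D ∈ admissibleVacuumData X, IsPPNaked D → ∃ e F, …`, i.e. the
two stubs with the censored curve eliminated. -/
theorem tameCurvatureModeExit_iff :
    Summit.FinalStateConjecture.FinalStateConjecture.Theses.CurvatureOrSymmetry.TameCurvatureModeExit ↔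
      ∀ (X : Type) [TopologicalSpace X] [ChartedSpace E3 X] [IsManifold (𝓡 3) ∞ X] [T2Space X]
        [SecondCountableTopology X] [ConnectedSpace X],
        ∀ D ∈ admissibleVacuumData X, IsPPNaked D →
          ∃ (e : AFEnd X) (F : EuclideanSpace ℝ (Fin 1) → InitialDataSet (𝓡 3) X),
            IsTameCurveThrough e F D ∧ EventuallyOffZero F IsGood := by
  constructor
  · intro h X _ _ _ _ _ _ D hD hpp
    obtain ⟨e, F, htame, himm, h0, hinj, hadm, ε, hε, hgood⟩ := h X D hD hpp
    exact ⟨e, F, ⟨htame, himm, h0, hinj, hadm⟩, ε, hε, fun c hc hcε ↦ hgood c hc hcε⟩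
  · intro h X _ _ _ _ _ _ D hD hpp
    obtain ⟨e, F, ⟨htame, himm, h0, hinj, hadm⟩, ε, hε, hgood⟩ := h X D hD hpp
    exact ⟨e, F, htame, himm, h0, hinj, hadm, ε, hε, fun c hc hcε ↦ hgood c hc hcε⟩

end Summit.FinalStateConjecture.FinalStateConjecture.Cruxes.TameCurvatureModeExit.Birth

end
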